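import Literature.MathematicalPhysics.QuantumFieldTheory.Balaban1983to89.B4StripSums
import Literature.MathematicalPhysics.QuantumFieldTheory.Balaban1983to89.Beta.SymbolExpansion

/-!
# Beta/AliasRatioStrip — the k-UNIFORM COMPLEX-NEIGHBOURHOOD ANALYTICITY AND SUP BOUND of the alias ratios
# `t_λ(p′) − 1` of Bałaban's symbol `a_λ = Δ₀φ_λ` (1.62) at U = 1 (β sub-cell row an1, node L1-STRIP = statement (S_t)
# of BETA-SPEC 7.8 (ii)/7.9; HOME/BETA/AN1.md §14.6) — v1.1 (v1 + §7: the `l ≠ 0` tail is quadratically small; complex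
# QUARTIC smallness of `t_λ − 1`, uniformly in k)

HONEST FRAMING (cell `pub-balaban`, BETA-SPEC): discharging the flow-side hypothesis `BetaPertH` of Bałaban's
[Balaban1987RG1] Theorem 2 would make the ultraviolet STABILITY of four-dimensional pure Yang–Mills lattice gauge
theory UNCONDITIONAL (in the interval-hypothesis sense of [Balaban1989LargeFieldII] p. 355) — a real constructive-QFT
result; it is NOT the continuum limit and NOT the Clay problem.  (Gloss 1, BETA-SPEC v1.8d l. 17–22, GAPS G-ref2-14 (a)
/ G-ref2-20 (a) / G-ref2-24 (a), verbatim: «UNCONDITIONAL» in [Balaban1989LargeFieldII] (B16) p. 355's interval-hypothesis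
sense ONLY (`FlowStepRuns.p355Unconditional_of_partialSums` keeps `hnodes`); the located leaves G-adv3-2 (left inequality
of (0.1)/(2.50), d = 4), G-adv3-1 (U2 transfer of B14 Cor. 3's lower bound) and `SecondExpLeaf` REMAIN.  Gloss 2,
BETA-SPEC v1.9e l. 23–25, beta-ref C-beta-78, BINDING: «UNCONDITIONAL» = `Beta.Assembly.EventualForm`-unconditional — the
END statement with the interval hypothesis removed, (0.31) in DEFECTED form on all lattices
(`PrefixAbsorption.thm2Defected_of_eventualForm`), admissible couplings shrunk to g ≤ g⋆; NOT «B12 Theorem 2 as printed»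
(`eventualForm_not_thm2Printed`, RULING (R6)); never the continuum limit / mass gap / Clay.)  This module asserts
NOTHING about Bałaban's β-functions and introduces no `def … : Prop` hypothesis shape: it proves [folklore]
complex analysis about two printed DEFINITIONS of
[Balaban1984PropagatorsI] (T. Bałaban, Propagators and renormalization transformations for lattice gauge theories I,
Commun. Math. Phys. **95** (1984) 17–40; INDEX B5), (1.61)–(1.62) p. 28, in the momentum vocabulary ALREADY vendored by
`B4Strip`, `B4StripCauchy`, `B5Strip145Analytic`, `B4StripSums` and `Beta.SymbolExpansion`.  No symbol is re-defined and no
upstream inequality is re-proved.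

## Printed inputs (verbatim, with page)

* [Balaban1984PropagatorsI] (1.61)–(1.62) p. 28 [PDF 12]: `v_μ(p) = ∂¹_μ(p′)/∂_μ(p)`;
  `φ_μ(p′) = Σ_l |u(p′+l)|² |v_μ(p′+l)|² / Δ(p′+l)`; «Multiplying φ_μ(p′) by Δ₀(p′), we get a well-defined positive
  function for all p′ ∈ T̃₁^{(k)}, 0 < γ₀ ≤ Δ₀(p′)φ_μ(p′) ≤ γ₁»; (1.66) p. 29 [PDF 13]: the bracket
  `[(Σ_λ |∂¹_λ(p′)|²/(Δ₀²(p′)φ_λ(p′))) · Δ₀(p′)φ_μ(p′) Δ₀(p′)φ_ν(p′)]⁻¹` (= `Beta.SymbolExpansion.sigmaSym`).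
* [Balaban1983RegularityDecay] (T. Bałaban, Regularity and decay of lattice Green's functions, Commun. Math. Phys. **89**
  (1983) 571–597; INDEX B4) p. 586 [PDF 16], after (2.51), about the momentum sums of the SAME averaging symbols
  `u_j(p′+l)`, `Δ^ξ(p′+l)`: «The expression is a function of p′ and can be extended as an analytic function to some
  neighbourhood of [−π,π]^d. It is more troublesome, but equally elementary, to prove that this neighbourhood can be
  chosen independently of j and that the expression is bounded also in this neighbourhood.»  (ASSERTED in print, not
  written; the cell's `B4StripCauchy`/`B4StripSums` supply it for (2.48).  THIS module supplies the analogous statement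
  for the alias ratios of (1.62); nothing printed is used as a hypothesis.)

## Dictionary (`n = L^k = η⁻¹ ≥ 1`, `l = 2πk`, `k : Fin d → Fin n`; complex `p : Fin d → ℂ`, real `s : Fin d → ℝ`)

Real side (`Beta.SymbolExpansion`, `B5Prop11Leaves`): `a_λ(p′) = aSym n λ s = Σ_k Δ₀ |u(p′+l)|² |v_λ(p′+l)|²/Δ(p′+l)`,
its `l = 0` term `T₀,λ = aSymZero n λ s`, the ALIAS RATIO `t_λ := a_λ/T₀,λ = tRatio n λ s`
(`aSym_eq_aSymZero_mul_tRatio`, `1 ≤ t_λ ≤ 1 + |p′|⁴/(48(4/π²)^(d+1))`, `tRatio_sub_one_le'`), and the exact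
factorisation `σ_{k,μν} = F_k·[t_μ t_ν Σ_λ ω_λ/t_λ]⁻¹` (`sigmaSym_factorisation`) which isolates ALL non-explicit
content of `σ_k` (1.66) in the `t_λ`.  Complex side (`B4Strip`, `B4StripSums`): `U n k p = |u(p′+l)|²` continued,
`uFactor n j z = |v(z + 2πj)|²`-factor continued (removable point filled), `DeltaXi n 0 p = Δ^η(p)` continued,
`R n 0 k p = Δ^η(p′)/Δ^η(p′+l)` (`k ≠ 0`; the REGROUPED ratio — holomorphic on the fat region although `1/Δ^η(p′)` is
not, `B4Strip.printed_factor_has_poles`), the fat region `Fat d r = {|Re p_ν| ≤ π + r, |Im p_ν| ≤ 2r}` and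
`rOf d = 1/(4(d+1))` of `B4StripCauchy`.

NEW here (definitions, [folklore] combinations of the above):
`numT n λ p := Σ_{k ≠ 0} U n k p · uFactor n k_λ p_λ · R n 0 k p`, `denT n λ p := U n 0 p · uFactor n 0 p_λ`,
`tSubOne n λ p := numT/denT` — the holomorphic continuation of `t_λ(p′) − 1` (`tSubOne_ofRealVec`: on the punctured
real zone `tSubOne n λ p′ = t_λ(p′) − 1`; the Laplacian ratio `Δ₀/Δ^η` and the factor `Δ₀`, which have no k-uniform
holomorphic continuation, CANCEL in the quotient `a_λ/T₀,λ` before continuation).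

## What is proved (every statement for EVERY `n ≥ 1`, i.e. uniformly in k; constants explicit, depending on d only)

* §1 one variable: `norm_uFactor_zero_ge : 3/16 ≤ ‖uFactor n 0 z‖` on the fat box `|Re z| ≤ π + r`, `|Im z| ≤ 2r`,
  `r ≤ 1/4` (the continued `|v(p′)|² = sin²(z/2)/(n² sin²(z/2n))` has NO zero near the Brillouin zone: Jordan's
  inequality on `|Re z| ≤ π`, and `sin²(x/2) ≥ 3/4` on `π ≤ |x| ≤ π + 1/4`); `norm_uFactor_le_64`.
* §2 the real dictionary: `numT_ofRealVec`, `denT_ofRealVec`, `tRatio_sub_one_eq` (the `l ≠ 0` sum form of `t_λ − 1`),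
  `tSubOne_ofRealVec : tSubOne n λ (ofRealVec p′) = ((t_λ(p′) − 1 : ℝ) : ℂ)` on the punctured zone (`tRatio_eq_one_add_re`),
  `numT_zero` / `tSubOne_zero` (`tSubOne = 0` at `p = 0`, the removable point).
* §3 bounds on the fat region `Fat d r`, `r ≤ 1/4`, `d r² ≤ 1/16`: `norm_denT_ge : (3/16)^(d+1) ≤ ‖denT‖`;
  `norm_R_zero_le : ‖R n 0 k p‖ ≤ (64/7)‖Δ^η(p)‖` (`k ≠ 0`, from `B4StripSums.re_DeltaXi_shift_ge_W`);
  `norm_numT_le : ‖numT‖ ≤ 132^d·64·(64/7)·‖Δ^η(p)‖` (`B4StripCauchy.sum_norm_U_le`); hence with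
  `CT d := 132^d·64·(64/7)/(3/16)^(d+1)`: `norm_tSubOne_le_mul : ‖tSubOne‖ ≤ CT d·‖Δ^η(p)‖`, the UNIFORM BOUND
  `norm_tSubOne_le : ‖tSubOne n λ p‖ ≤ MT d := CT d·16d`, and the quadratic smallness
  `norm_tSubOne_le_sq : ‖tSubOne n λ p‖ ≤ CT d·(25/16)·Σ_ν ‖p_ν‖²`.
* §4 joint holomorphy at every point of the fat region: `differentiableAt_numT/denT/tSubOne`, `denT_ne_zero`,
  `continuousOn_tSubOne`.
* §5 THE STATEMENT (S_t) (BETA-SPEC 7.9 (ii) as re-worded by the lead; AN1.md §14.6): `aliasRatio_fat` (on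
  `Fat d (rOf d)`) and `statement_St : ∃ δ > 0, ∃ C ≥ 0, ∀ n ≥ 1, ∀ λ, (tSubOne n λ is holomorphic with ‖·‖ ≤ C at every
  p with |Re p_ν| ≤ π + δ, |Im p_ν| ≤ δ) ∧ (tSubOne = t_λ − 1 on the punctured real zone)`, `δ = rOf d`, `C = MT d`.
* §6 the first Cauchy consequence (tree engine `B4StripCauchy.norm_deriv_slice_le`, Conway IV.2.14):
  `norm_deriv_tSubOne_le : ‖∂_μ tSubOne n λ (q)‖ ≤ MT d/rOf d` at every point of every strip `Strip d κ`, `κ ≤ rOf d`,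
  in particular at every real momentum (`norm_deriv_tSubOne_le_real`), and the imaginary-direction Lipschitz bound
  `tSubOne_imLipschitz` — all uniformly in k.
* §7 (v1.1) the `l ≠ 0` TAIL and QUARTIC smallness on the fat region (`r ≤ 1/4`, `d r² ≤ 1/16`), every `n ≥ 1`:
  `sum_norm_uFactor_ne_le : Σ_{j ≠ 0} ‖uFactor n j z‖ ≤ 8‖S1 z‖` (one variable; the shifted weights keep the factor
  `S1 z = 4 sin²(z/2)`, `B4StripCauchy.inv_norm_Sxi_shift_le` and `Σ 1/(j+1)² ≤ 2`), the union bound over the nonzero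
  coordinate and the box factorisation `Finset.prod_univ_sum` (`sum_erase_zero_le_sum_coord`, `sum_filter_coord_ne_prod`),
  `sum_norm_U_ne_le : Σ_{k ≠ 0} ‖U n k p‖ ≤ 8·132^d·Σ_μ ‖S1(p_μ)‖ ≤ (25/2)·132^d·Σ_μ ‖p_μ‖²` (`sum_norm_U_ne_le_norm_sq`);
  hence `norm_numT_le_tail`, `norm_tSubOne_le_tail : ‖tSubOne‖ ≤ 8·CT d·‖Δ^η(p)‖·Σ_μ‖S1(p_μ)‖` and, with
  `CT4 d := 8·(25/16)²·CT d`, the COMPLEX QUARTIC SMALLNESS `norm_tSubOne_le_pow_four : ‖tSubOne n λ p‖ ≤ CT4 d·(Σ_ν ‖p_ν‖²)²`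
  on the WHOLE fat region, and `aliasRatio_fat_quartic : ‖tSubOne n λ p‖ ≤ min (MT d) (CT4 d·(Σ‖p_ν‖²)²)` on `Fat d (rOf d)`.

## What this is for, and what it is NOT

With `Beta.SymbolExpansion.sigmaSym_factorisation` (§7 there) the strip/derivative content of BETA-SPEC 7.8 (ii) («strip/derivative versions of
an1's Theorems A/B») concerns the alias ratios `t_λ` only (`F_k`, `ω_λ` are explicit).  This module closes the located
statement (S_t) for them: a k-uniform complex neighbourhood of the CLOSED zone `[−π,π]^d` (fat in `Re` as well, since
`t_λ` — an `l = 0`-relative object — is not `2π`-periodic, so Cauchy discs at the zone's faces need `|Re p_ν| ≤ π + δ`),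
holomorphy and a uniform bound there, and the first derivative bound.  Higher `∂^α` bounds follow by iterating Cauchy's
estimate on the same fat region (recorded on paper, HOME/BETA/AN1.md §15; the real fourth-order smallness at `p′ = 0` is
the kernel statement `Beta.SymbolExpansion.tRatio_sub_one_le'`; its complex, k-uniform form to FOURTH order on the whole
fat region is `norm_tSubOne_le_pow_four` (§7, v1.1), to second order `norm_tSubOne_le_sq`).  NOT covered: iterated
derivatives as kernel statements, anything at U ≠ 1, the Woodbury blocks (1.70)–(1.83), and — of course — any statement
about β.  Cell rule honoured: no
internally-minted statement enters as a cited fact; the only [cite:] tags sit on the three dictionary definitions.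
v1.2 (DOCFIX, header only, GAPS G-ref2-24 (a)): glosses 1–2 of the honest framing carried verbatim; no declaration changed.
-/

namespace Literature.MathematicalPhysics.QuantumFieldTheory.Balaban1983to89.Beta.AliasRatioStrip

open Finset
open Literature.MathematicalPhysics.QuantumFieldTheory.Balaban1983to89.B4Strip
open Literature.MathematicalPhysics.QuantumFieldTheory.Balaban1983to89.B4StripCauchy
open Literature.MathematicalPhysics.QuantumFieldTheory.Balaban1983to89.B5Strip145Analytic (dAt_div differentiableAt_U)
open Literature.MathematicalPhysics.QuantumFieldTheory.Balaban1983to89.B4StripSums (R W one_le_W re_DeltaXi_shift_ge_W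
  differentiableAt_R)
open Literature.MathematicalPhysics.QuantumFieldTheory.Balaban1983to89.B5Prop11Leaves (Delta1r_pos DeltaXir_pos
  DeltaXir_shift_ge_four shiftr_zero)
open Literature.MathematicalPhysics.QuantumFieldTheory.Balaban1983to89.Beta.SymbolExpansion (aSym aSymZero tRatio
  aSymZero_eq_summand aSymZero_pos Ur_zero_pos uFactorr_zero_pos)

noncomputable section

variable {d : ℕ}

/-! ## §0. The three definitions -/

/-- the `l ≠ 0` NUMERATOR of `t_λ − 1`: `N_{n,λ}(p) := Σ_{k ≠ 0} |u(p+2πk)|² · |v_λ(p_λ+2πk_λ)|² · Δ^η(p)/Δ^η(p+2πk)`,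
continued to complex `p` factor by factor with the REGROUPED ratio `R n 0 k p` (numerator `Δ^η(p)` inside).
[cite: Balaban1984PropagatorsI, (1.61)–(1.62) p.28 (the `l ≠ 0` part of `Δ₀φ_λ`, divided by `Δ₀|u(p′)|²|v_λ(p′)|²/Δ(p′)`; regrouped by the audit)] -/
def numT (n : ℕ) [NeZero n] (lam : Fin d) (p : Fin d → ℂ) : ℂ :=
  ∑ k ∈ Finset.univ.erase (fun _ => (0 : Fin n)), U n k p * uFactor n (k lam : ℕ) (p lam) * R n 0 k p

/-- the DENOMINATOR `D_{n,λ}(p) := |u(p)|² · |v_λ(p_λ)|²` of `t_λ − 1` (the `l = 0` weights, removable points filled),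
continued to complex `p`. [cite: Balaban1984PropagatorsI, (1.61)–(1.62) p.28 (the factors `|u(p′)|²|v_μ(p′)|²` of the `l = 0` term)] -/
def denT (n : ℕ) [NeZero n] (lam : Fin d) (p : Fin d → ℂ) : ℂ :=
  U n (fun _ => (0 : Fin n)) p * uFactor n 0 (p lam)

/-- `tSubOne n λ p := N_{n,λ}(p)/D_{n,λ}(p)` — the holomorphic continuation of the alias ratio minus one,
`t_λ(p′) − 1 = a_λ(p′)/T₀,λ(p′) − 1` (`tSubOne_ofRealVec`). [cite: Balaban1984PropagatorsI, (1.61)–(1.62) p.28 (ratio of the printed `Δ₀φ_λ` to its `l = 0` term, minus one; the audit's regrouping)] -/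
def tSubOne (n : ℕ) [NeZero n] (lam : Fin d) (p : Fin d → ℂ) : ℂ :=
  numT n lam p / denT n lam p

/-! ## §1. One variable: the continued `l = 0` weight `|v(z)|² = sin²(z/2)/(n² sin²(z/2n))` has modulus `≥ 3/16`
on the fat box, uniformly in `n ≥ 1` -/

/-- `sin²(x/2) ≥ 3/4` for `π ≤ |x| ≤ π + 1/4` (Jordan's inequality at the complementary angle). [folklore] -/
theorem sin_sq_half_ge {x : ℝ} (h1 : Real.pi ≤ |x|) (h2 : |x| ≤ Real.pi + 1 / 4) :
    3 / 4 ≤ Real.sin (x / 2) ^ 2 := by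
  have hπ := Real.pi_gt_three
  have hsq : Real.sin (x / 2) ^ 2 = Real.sin (|x| / 2) ^ 2 := by
    rcases abs_choice x with h | h
    · rw [h]
    · rw [h, neg_div, Real.sin_neg, neg_sq]
  rw [hsq]
  set u := |x| / 2 with hu
  have hu1 : Real.pi / 2 ≤ u := by rw [hu]; linarith
  have hu2 : u ≤ Real.pi / 2 + 1 / 8 := by rw [hu]; linarith
  have hsin : Real.sin u = Real.sin (Real.pi - u) := (Real.sin_pi_sub u).symm
  have hj : 2 / Real.pi * (Real.pi - u) ≤ Real.sin (Real.pi - u) :=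
    Real.mul_le_sin (by linarith) (by linarith)
  have hlow : 11 / 12 ≤ 2 / Real.pi * (Real.pi - u) := by
    rw [div_mul_eq_mul_div, le_div_iff₀ Real.pi_pos]
    nlinarith
  have hs : 11 / 12 ≤ Real.sin u := by rw [hsin]; linarith
  nlinarith

/-- `‖S₁(z)‖ ≥ (4/π²)(Re z)² + (Im z)²` for `|Re z| ≤ π` (`B4StripCauchy.norm_Sxi_ge` at `n = 1`). [folklore] -/
theorem norm_S1_ge_of_abs_re_le {z : ℂ} (hx : |z.re| ≤ Real.pi) :
    4 / Real.pi ^ 2 * z.re ^ 2 + z.im ^ 2 ≤ ‖S1 z‖ := by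
  rw [S1_eq_Sxi_one]
  exact norm_Sxi_ge 1 le_rfl z (by simpa using hx)

/-- `‖S₁(z)‖ ≥ 3` for `π ≤ |Re z| ≤ π + r`, `r ≤ 1/4` (any `Im z`). [folklore] -/
theorem norm_S1_ge_three {z : ℂ} {r : ℝ} (hr : r ≤ 1 / 4) (h1 : Real.pi ≤ |z.re|)
    (hx : |z.re| ≤ Real.pi + r) : 3 ≤ ‖S1 z‖ := by
  have h := norm_Sxi_ge_sin 1 one_ne_zero z
  have hs := sin_sq_half_ge h1 (by linarith)
  rw [S1_eq_Sxi_one]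
  have e : Real.sin (z.re / (2 * ((1 : ℕ) : ℝ))) = Real.sin (z.re / 2) := by norm_num
  rw [e] at h
  norm_num at h
  linarith

/-- **`3/16 ≤ ‖uFactor n 0 z‖` on the fat box `|Re z| ≤ π + r`, `|Im z| ≤ 2r`, `r ≤ 1/4`, for EVERY `n ≥ 1`**: the
continued `l = 0` weight `|v(z)|²` (value `1` at the removable point `z = 0`) stays away from zero near the closed
Brillouin zone, uniformly in the block size. [folklore] -/
theorem norm_uFactor_zero_ge (n : ℕ) (hn : 1 ≤ n) {z : ℂ} {r : ℝ} (hr : r ≤ 1 / 4)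
    (hx : |z.re| ≤ Real.pi + r) (hy : |z.im| ≤ 2 * r) : 3 / 16 ≤ ‖uFactor n 0 z‖ := by
  rw [uFactor_zero_eq]
  split_ifs with hz
  · norm_num
  · have hπ := Real.pi_gt_three
    have hπ' := Real.pi_lt_d2
    have hx2 : |z.re| < 2 * Real.pi := by linarith
    have hS : Sxi n z ≠ 0 := Sxi_ne_zero n hn hx2 hz
    have hSpos : 0 < ‖Sxi n z‖ := norm_pos_iff.mpr hS
    rw [norm_div, le_div_iff₀ hSpos]
    by_cases hxπ : |z.re| ≤ Real.pi
    · have hup : ‖Sxi n z‖ ≤ z.re ^ 2 + 25 / 16 * z.im ^ 2 := norm_Sxi_le n hn z (by linarith)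
      have hlo := norm_S1_ge_of_abs_re_le hxπ
      have hc : 3 / 16 ≤ 4 / Real.pi ^ 2 := by
        rw [div_le_div_iff₀ (by norm_num) (by positivity)]
        nlinarith
      have h1 : 3 / 16 * z.re ^ 2 ≤ 4 / Real.pi ^ 2 * z.re ^ 2 :=
        mul_le_mul_of_nonneg_right hc (sq_nonneg _)
      nlinarith [sq_nonneg z.im]
    · push Not at hxπ
      have h3 : 3 ≤ ‖S1 z‖ := norm_S1_ge_three hr hxπ.le hx
      have h16 : ‖Sxi n z‖ ≤ 16 := norm_Sxi_le_16 n hn hr hx hy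
      nlinarith

/-- `‖uFactor n j z‖ ≤ 64` on the fat box for EVERY residue `j` and every `n ≥ 1` (crude form of
`B4StripCauchy.norm_uFactor_zero_le` / `norm_uFactor_ne_le`). [folklore] -/
theorem norm_uFactor_le_64 (n : ℕ) [NeZero n] (j : Fin n) {z : ℂ} {r : ℝ} (hr : r ≤ 1 / 4)
    (hx : |z.re| ≤ Real.pi + r) (hy : |z.im| ≤ 2 * r) : ‖uFactor n (j : ℕ) z‖ ≤ 64 := by
  have hn : 1 ≤ n := Nat.one_le_iff_ne_zero.mpr (NeZero.ne n)
  by_cases hj : (j : ℕ) = 0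
  · rw [hj]
    have := norm_uFactor_zero_le n hn hr hx hy (z := z)
    linarith
  · have hj1 : 1 ≤ (j : ℕ) := Nat.one_le_iff_ne_zero.mpr hj
    have hjn : (j : ℕ) + 1 ≤ n := j.isLt
    have h := norm_uFactor_ne_le n j hj1 hjn hr hx hy (z := z)
    have ha : (1 : ℝ) ≤ ((j : ℕ) : ℝ) + 1 := by
      have : (0 : ℝ) ≤ ((j : ℕ) : ℝ) := Nat.cast_nonneg _
      linarith
    have hb : (1 : ℝ) ≤ (n : ℝ) - (j : ℕ) := by
      have : ((j : ℕ) : ℝ) + 1 ≤ n := by exact_mod_cast hjn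
      linarith
    have ha2 : (1 : ℝ) ≤ (((j : ℕ) : ℝ) + 1) ^ 2 := by nlinarith
    have hb2 : (1 : ℝ) ≤ ((n : ℝ) - (j : ℕ)) ^ 2 := by nlinarith
    have h1 : 32 / (((j : ℕ) : ℝ) + 1) ^ 2 ≤ 32 := div_le_self (by norm_num) ha2
    have h2 : 32 / ((n : ℝ) - (j : ℕ)) ^ 2 ≤ 32 := div_le_self (by norm_num) hb2
    linarith

/-! ## §2. The real dictionary: on the punctured zone `tSubOne = t_λ − 1` -/

/-- the numerator on real momenta. [folklore] -/
theorem numT_ofRealVec (n : ℕ) [NeZero n] (lam : Fin d) (s : Fin d → ℝ) :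
    numT n lam (ofRealVec s) = ((∑ k ∈ Finset.univ.erase (fun _ => (0 : Fin n)),
      Ur n k s * uFactorr n (k lam : ℕ) (s lam) * (DeltaXir n 0 s / DeltaXir n 0 (shiftr n k s)) : ℝ) : ℂ) := by
  unfold numT
  push_cast
  refine Finset.sum_congr rfl (fun k hk => ?_)
  have hk0 : k ≠ fun _ => 0 := Finset.ne_of_mem_erase hk
  have hR : R n 0 k (ofRealVec s) = DeltaXi n 0 (ofRealVec s) / DeltaXi n 0 (shift n k (ofRealVec s)) := by
    unfold R; rw [if_neg hk0]
  have hl : ofRealVec s lam = ((s lam : ℝ) : ℂ) := rfl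
  rw [hR, U_ofReal, hl, uFactor_ofReal, shift_ofReal, DeltaXi_ofReal, DeltaXi_ofReal]

/-- the denominator on real momenta. [folklore] -/
theorem denT_ofRealVec (n : ℕ) [NeZero n] (lam : Fin d) (s : Fin d → ℝ) :
    denT n lam (ofRealVec s) = ((Ur n (fun _ => (0 : Fin n)) s * uFactorr n 0 (s lam) : ℝ) : ℂ) := by
  unfold denT
  have hl : ofRealVec s lam = ((s lam : ℝ) : ℂ) := rfl
  rw [U_ofReal, hl, uFactor_ofReal]
  push_cast
  ring

/-- **the `l ≠ 0` sum form of `t_λ − 1`** on the punctured zone: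
`t_λ(p′) − 1 = [Σ_{l ≠ 0} |u(p′+l)|² |v_λ(p′_λ+l_λ)|² Δ(p′)/Δ(p′+l)] / [|u(p′)|² |v_λ(p′_λ)|²]` — the factor `Δ₀(p′)`
and the Laplacian ratio `Δ₀/Δ^η` of `T₀,λ` cancel. [folklore] -/
theorem tRatio_sub_one_eq (n : ℕ) [NeZero n] (hn : 1 ≤ n) (s : Fin d → ℝ) (hs : ∀ ν, |s ν| ≤ Real.pi)
    (ν₀ : Fin d) (hν₀ : s ν₀ ≠ 0) (lam : Fin d) :
    tRatio n lam s - 1 = (∑ k ∈ Finset.univ.erase (fun _ => (0 : Fin n)),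
      Ur n k s * uFactorr n (k lam : ℕ) (s lam) * (DeltaXir n 0 s / DeltaXir n 0 (shiftr n k s)))
        / (Ur n (fun _ => (0 : Fin n)) s * uFactorr n 0 (s lam)) := by
  have hZ : aSymZero n lam s ≠ 0 := ne_of_gt (aSymZero_pos n hn s hs ν₀ hν₀ lam)
  have hD0 : Delta1r 0 s ≠ 0 := ne_of_gt (Delta1r_pos s hs ν₀ hν₀)
  have hDx : DeltaXir n 0 s ≠ 0 := ne_of_gt (DeltaXir_pos n hn s hs ν₀ hν₀)
  have hU : Ur n (fun _ => (0 : Fin n)) s ≠ 0 := ne_of_gt (Ur_zero_pos n hn s hs)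
  have huf : uFactorr n 0 (s lam) ≠ 0 := ne_of_gt (uFactorr_zero_pos n hn (hs lam))
  have hnum : aSym n lam s - aSymZero n lam s = ∑ k ∈ Finset.univ.erase (fun _ => (0 : Fin n)),
      Delta1r 0 s * Ur n k s * uFactorr n (k lam : ℕ) (s lam) / DeltaXir n 0 (shiftr n k s) := by
    rw [aSymZero_eq_summand]
    unfold aSym
    rw [Finset.sum_erase_eq_sub (Finset.mem_univ _)]
  unfold tRatio
  rw [div_sub_one hZ, hnum, Finset.sum_div, Finset.sum_div]
  refine Finset.sum_congr rfl (fun k hk => ?_)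
  have hk0 : k ≠ fun _ => 0 := Finset.ne_of_mem_erase hk
  have hDk : DeltaXir n 0 (shiftr n k s) ≠ 0 := by
    have := DeltaXir_shift_ge_four n k hk0 s hs
    exact ne_of_gt (by linarith)
  unfold aSymZero
  field_simp

/-- **`tSubOne` IS `t_λ − 1` on the punctured real zone** (`|p′_ν| ≤ π`, `p′ ≠ 0`), for every `n ≥ 1`. [folklore] -/
theorem tSubOne_ofRealVec (n : ℕ) [NeZero n] (hn : 1 ≤ n) (s : Fin d → ℝ) (hs : ∀ ν, |s ν| ≤ Real.pi)
    (ν₀ : Fin d) (hν₀ : s ν₀ ≠ 0) (lam : Fin d) :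
    tSubOne n lam (ofRealVec s) = ((tRatio n lam s - 1 : ℝ) : ℂ) := by
  unfold tSubOne
  rw [numT_ofRealVec, denT_ofRealVec, tRatio_sub_one_eq n hn s hs ν₀ hν₀ lam]
  push_cast
  rfl

/-- real form: `t_λ(p′) = 1 + Re (tSubOne n λ p′)` and `Im (tSubOne n λ p′) = 0` on the punctured zone. [folklore] -/
theorem tRatio_eq_one_add_re (n : ℕ) [NeZero n] (hn : 1 ≤ n) (s : Fin d → ℝ) (hs : ∀ ν, |s ν| ≤ Real.pi)
    (ν₀ : Fin d) (hν₀ : s ν₀ ≠ 0) (lam : Fin d) :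
    tRatio n lam s = 1 + (tSubOne n lam (ofRealVec s)).re ∧ (tSubOne n lam (ofRealVec s)).im = 0 := by
  rw [tSubOne_ofRealVec n hn s hs ν₀ hν₀ lam, Complex.ofReal_re, Complex.ofReal_im]
  exact ⟨by ring, rfl⟩

/-- at the removable point `p = 0` the numerator vanishes (every `l ≠ 0` term carries a factor
`|v(0 + 2πk_μ)|² = S₁(0)/S_ξ(2πk_μ) = 0`, `k_μ ≠ 0`), so `tSubOne n λ 0 = 0` — consistent with `t_λ − 1 = O(|p′|⁴)`
(`Beta.SymbolExpansion.tRatio_sub_one_le'`). [folklore] -/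
theorem numT_zero (n : ℕ) [NeZero n] (lam : Fin d) : numT n lam (fun _ => (0 : ℂ)) = 0 := by
  unfold numT
  refine Finset.sum_eq_zero (fun k hk => ?_)
  have hk0 : k ≠ fun _ => 0 := Finset.ne_of_mem_erase hk
  obtain ⟨μ, hμ⟩ : ∃ μ, k μ ≠ 0 := Function.ne_iff.mp hk0
  have hj : (k μ : ℕ) ≠ 0 := fun h => hμ (Fin.ext h)
  have hU : U n k (fun _ => (0 : ℂ)) = 0 := by
    unfold U
    exact Finset.prod_eq_zero (Finset.mem_univ μ) (by simp [uFactor, hj, S1])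
  rw [hU, zero_mul, zero_mul]

/-- `tSubOne n λ 0 = 0`. [folklore] -/
theorem tSubOne_zero (n : ℕ) [NeZero n] (lam : Fin d) : tSubOne n lam (fun _ => (0 : ℂ)) = 0 := by
  unfold tSubOne; rw [numT_zero, zero_div]

/-! ## §3. Bounds on the fat region, uniform in `n ≥ 1` -/

/-- **`(3/16)^(d+1) ≤ ‖denT n λ p‖` on the fat region** `Fat d r`, `r ≤ 1/4`, every `n ≥ 1`. [folklore] -/
theorem norm_denT_ge (n : ℕ) [NeZero n] (lam : Fin d) {r : ℝ} (hr : r ≤ 1 / 4) {q : Fin d → ℂ}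
    (hq : q ∈ Fat d r) : (3 / 16 : ℝ) ^ (d + 1) ≤ ‖denT n lam q‖ := by
  have hn : 1 ≤ n := Nat.one_le_iff_ne_zero.mpr (NeZero.ne n)
  unfold denT
  rw [norm_mul, norm_U_eq, pow_succ]
  have hU : (3 / 16 : ℝ) ^ d ≤ ∏ ν, ‖uFactor n (((fun _ => (0 : Fin n)) ν : Fin n) : ℕ) (q ν)‖ := by
    calc (3 / 16 : ℝ) ^ d = ∏ _ν : Fin d, (3 / 16 : ℝ) := by
          rw [Finset.prod_const, Finset.card_univ, Fintype.card_fin]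
      _ ≤ ∏ ν, ‖uFactor n (((fun _ => (0 : Fin n)) ν : Fin n) : ℕ) (q ν)‖ :=
          Finset.prod_le_prod (fun _ _ => by norm_num)
            (fun ν _ => by rw [Fin.val_zero]; exact norm_uFactor_zero_ge n hn hr (hq ν).1 (hq ν).2)
  have hu : (3 / 16 : ℝ) ≤ ‖uFactor n 0 (q lam)‖ := norm_uFactor_zero_ge n hn hr (hq lam).1 (hq lam).2
  exact mul_le_mul hU hu (by norm_num) (le_trans (by positivity) hU)

/-- the denominator does not vanish on the fat region. [folklore] -/
theorem denT_ne_zero (n : ℕ) [NeZero n] (lam : Fin d) {r : ℝ} (hr : r ≤ 1 / 4) {q : Fin d → ℂ}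
    (hq : q ∈ Fat d r) : denT n lam q ≠ 0 := by
  have h := norm_denT_ge n lam hr hq
  have hpos : (0 : ℝ) < (3 / 16 : ℝ) ^ (d + 1) := by positivity
  intro h0
  rw [h0, norm_zero] at h
  linarith

/-- **`‖R n 0 k p‖ ≤ (64/7)‖Δ^η(p)‖`** on the fat region (`k ≠ 0`, `r ≤ 1/4`, `d r² ≤ 1/16`, `m² = 0`): the shifted
denominator has real part `≥ (7/64)W_n(k) ≥ 7/64` (`B4StripSums.re_DeltaXi_shift_ge_W`). [folklore] -/
theorem norm_R_zero_le (n : ℕ) [NeZero n] {r : ℝ} (hr : r ≤ 1 / 4) (hdr : (d : ℝ) * r ^ 2 ≤ 1 / 16)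
    {q : Fin d → ℂ} (hq : q ∈ Fat d r) (k : Fin d → Fin n) (hk : k ≠ fun _ => 0) :
    ‖R n 0 k q‖ ≤ 64 / 7 * ‖DeltaXi n 0 q‖ := by
  unfold R
  rw [if_neg hk, norm_div]
  have hW := one_le_W n k hk
  have hre := re_DeltaXi_shift_ge_W n 0 le_rfl hr hdr hq k hk
  have hden : 7 / 64 ≤ ‖DeltaXi n 0 (shift n k q)‖ := by
    have := Complex.re_le_norm (DeltaXi n 0 (shift n k q))
    nlinarith
  calc ‖DeltaXi n 0 q‖ / ‖DeltaXi n 0 (shift n k q)‖ ≤ ‖DeltaXi n 0 q‖ / (7 / 64) :=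
        div_le_div_of_nonneg_left (norm_nonneg _) (by norm_num) hden
    _ = 64 / 7 * ‖DeltaXi n 0 q‖ := by ring

/-- **`‖numT n λ p‖ ≤ 132^d · 64 · (64/7) · ‖Δ^η(p)‖`** on the fat region (`r ≤ 1/4`, `d r² ≤ 1/16`), every `n ≥ 1`
(`Σ_k ‖U n k p‖ ≤ 132^d`, `B4StripCauchy.sum_norm_U_le`). [folklore] -/
theorem norm_numT_le (n : ℕ) [NeZero n] (lam : Fin d) {r : ℝ} (hr : r ≤ 1 / 4)
    (hdr : (d : ℝ) * r ^ 2 ≤ 1 / 16) {q : Fin d → ℂ} (hq : q ∈ Fat d r) :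
    ‖numT n lam q‖ ≤ 132 ^ d * 64 * (64 / 7) * ‖DeltaXi n 0 q‖ := by
  unfold numT
  set B : ℝ := 64 * (64 / 7 * ‖DeltaXi n 0 q‖) with hB
  have hB0 : 0 ≤ B := by rw [hB]; positivity
  have hterm : ∀ k ∈ Finset.univ.erase (fun _ => (0 : Fin n)),
      ‖U n k q * uFactor n (k lam : ℕ) (q lam) * R n 0 k q‖ ≤ ‖U n k q‖ * B := by
    intro k hk
    have hk0 : k ≠ fun _ => 0 := Finset.ne_of_mem_erase hk
    rw [norm_mul, norm_mul, mul_assoc]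
    refine mul_le_mul_of_nonneg_left ?_ (norm_nonneg _)
    exact mul_le_mul (norm_uFactor_le_64 n (k lam) hr (hq lam).1 (hq lam).2)
      (norm_R_zero_le n hr hdr hq k hk0) (norm_nonneg _) (by norm_num)
  calc ‖∑ k ∈ Finset.univ.erase (fun _ => (0 : Fin n)), U n k q * uFactor n (k lam : ℕ) (q lam) * R n 0 k q‖
      ≤ ∑ k ∈ Finset.univ.erase (fun _ => (0 : Fin n)), ‖U n k q * uFactor n (k lam : ℕ) (q lam) * R n 0 k q‖ :=
        norm_sum_le _ _
    _ ≤ ∑ k ∈ Finset.univ.erase (fun _ => (0 : Fin n)), ‖U n k q‖ * B := Finset.sum_le_sum hterm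
    _ ≤ ∑ k : Fin d → Fin n, ‖U n k q‖ * B :=
        Finset.sum_le_univ_sum_of_nonneg (fun k => mul_nonneg (norm_nonneg _) hB0)
    _ = (∑ k : Fin d → Fin n, ‖U n k q‖) * B := by rw [Finset.sum_mul]
    _ ≤ 132 ^ d * B := mul_le_mul_of_nonneg_right (sum_norm_U_le n hr hq) hB0
    _ = 132 ^ d * 64 * (64 / 7) * ‖DeltaXi n 0 q‖ := by rw [hB]; ring

/-- `‖Δ^η(p)‖ ≤ Σ_ν ((Re p_ν)² + (25/16)(Im p_ν)²)` for `|Im p_ν| ≤ 1`, every `n ≥ 1` (`B4StripCauchy.norm_Sxi_le`). [folklore] -/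
theorem norm_DeltaXi_zero_le_sq (n : ℕ) (hn : 1 ≤ n) {q : Fin d → ℂ} (hq : ∀ ν, |(q ν).im| ≤ 1) :
    ‖DeltaXi n 0 q‖ ≤ ∑ ν, ((q ν).re ^ 2 + 25 / 16 * (q ν).im ^ 2) := by
  unfold DeltaXi
  rw [Complex.ofReal_zero, add_zero]
  exact (norm_sum_le _ _).trans (Finset.sum_le_sum (fun ν _ => norm_Sxi_le n hn (q ν) (hq ν)))

/-- `‖Δ^η(p)‖ ≤ (25/16) Σ_ν ‖p_ν‖²` for `|Im p_ν| ≤ 1`, every `n ≥ 1`. [folklore] -/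
theorem norm_DeltaXi_zero_le_norm_sq (n : ℕ) (hn : 1 ≤ n) {q : Fin d → ℂ} (hq : ∀ ν, |(q ν).im| ≤ 1) :
    ‖DeltaXi n 0 q‖ ≤ 25 / 16 * ∑ ν, ‖q ν‖ ^ 2 := by
  refine (norm_DeltaXi_zero_le_sq n hn hq).trans ?_
  rw [Finset.mul_sum]
  refine Finset.sum_le_sum (fun ν _ => ?_)
  rw [Complex.sq_norm, Complex.normSq_apply]
  nlinarith [sq_nonneg (q ν).re, sq_nonneg (q ν).im]

/-- the constant of the ratio bound: `C_T(d) = 132^d · 64 · (64/7) / (3/16)^(d+1)`. [folklore] -/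
def CT (d : ℕ) : ℝ := 132 ^ d * 64 * (64 / 7) / (3 / 16 : ℝ) ^ (d + 1)

/-- `C_T(d) ≥ 0`. [folklore] -/
theorem CT_nonneg (d : ℕ) : 0 ≤ CT d := by unfold CT; positivity

/-- the UNIFORM BOUND `M_T(d) = C_T(d) · 16 d`. [folklore] -/
def MT (d : ℕ) : ℝ := CT d * (16 * d)

/-- `M_T(d) ≥ 0`. [folklore] -/
theorem MT_nonneg (d : ℕ) : 0 ≤ MT d := by unfold MT; have := CT_nonneg d; positivity

/-- **`‖tSubOne n λ p‖ ≤ C_T(d) ‖Δ^η(p)‖`** on the fat region (`r ≤ 1/4`, `d r² ≤ 1/16`), every `n ≥ 1`. [folklore] -/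
theorem norm_tSubOne_le_mul (n : ℕ) [NeZero n] (lam : Fin d) {r : ℝ} (hr : r ≤ 1 / 4)
    (hdr : (d : ℝ) * r ^ 2 ≤ 1 / 16) {q : Fin d → ℂ} (hq : q ∈ Fat d r) :
    ‖tSubOne n lam q‖ ≤ CT d * ‖DeltaXi n 0 q‖ := by
  unfold tSubOne CT
  rw [norm_div]
  have hden := norm_denT_ge n lam hr hq
  have hnum := norm_numT_le n lam hr hdr hq
  have hc : (0 : ℝ) < (3 / 16 : ℝ) ^ (d + 1) := by positivity
  have hpos : 0 < ‖denT n lam q‖ := lt_of_lt_of_le hc hden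
  rw [div_le_iff₀ hpos]
  calc ‖numT n lam q‖ ≤ 132 ^ d * 64 * (64 / 7) * ‖DeltaXi n 0 q‖ := hnum
    _ = 132 ^ d * 64 * (64 / 7) / (3 / 16 : ℝ) ^ (d + 1) * ‖DeltaXi n 0 q‖ * (3 / 16 : ℝ) ^ (d + 1) := by
        field_simp
    _ ≤ 132 ^ d * 64 * (64 / 7) / (3 / 16 : ℝ) ^ (d + 1) * ‖DeltaXi n 0 q‖ * ‖denT n lam q‖ :=
        mul_le_mul_of_nonneg_left hden (by positivity)

/-- **THE UNIFORM BOUND `‖tSubOne n λ p‖ ≤ M_T(d)`** on the fat region (`r ≤ 1/4`, `d r² ≤ 1/16`), for EVERY `n ≥ 1`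
and every direction `λ` (`‖Δ^η‖ ≤ 16d`, `B4StripCauchy.norm_DeltaXi_le`). [folklore] -/
theorem norm_tSubOne_le (n : ℕ) [NeZero n] (lam : Fin d) {r : ℝ} (hr : r ≤ 1 / 4)
    (hdr : (d : ℝ) * r ^ 2 ≤ 1 / 16) {q : Fin d → ℂ} (hq : q ∈ Fat d r) :
    ‖tSubOne n lam q‖ ≤ MT d := by
  have hn : 1 ≤ n := Nat.one_le_iff_ne_zero.mpr (NeZero.ne n)
  have h1 := norm_tSubOne_le_mul n lam hr hdr hq
  have h2 : ‖DeltaXi n 0 q‖ ≤ 16 * d := by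
    have := norm_DeltaXi_le n hn 0 le_rfl hr hq
    linarith
  unfold MT
  exact h1.trans (mul_le_mul_of_nonneg_left h2 (CT_nonneg d))

/-- **QUADRATIC SMALLNESS `‖tSubOne n λ p‖ ≤ C_T(d)·(25/16)·Σ_ν ‖p_ν‖²`** on the fat region (`r ≤ 1/4`,
`d r² ≤ 1/16`), every `n ≥ 1` — the complex form, to second order, of the vanishing of `t_λ − 1` at `p′ = 0`
(the real fourth-order statement is `Beta.SymbolExpansion.tRatio_sub_one_le'`). [folklore] -/
theorem norm_tSubOne_le_sq (n : ℕ) [NeZero n] (lam : Fin d) {r : ℝ} (hr : r ≤ 1 / 4)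
    (hdr : (d : ℝ) * r ^ 2 ≤ 1 / 16) {q : Fin d → ℂ} (hq : q ∈ Fat d r) :
    ‖tSubOne n lam q‖ ≤ CT d * (25 / 16) * ∑ ν, ‖q ν‖ ^ 2 := by
  have hn : 1 ≤ n := Nat.one_le_iff_ne_zero.mpr (NeZero.ne n)
  have h1 := norm_tSubOne_le_mul n lam hr hdr hq
  have hq1 : ∀ ν, |(q ν).im| ≤ 1 := fun ν => by linarith [(hq ν).2]
  have h2 := norm_DeltaXi_zero_le_norm_sq n hn hq1
  rw [mul_assoc]
  exact h1.trans (mul_le_mul_of_nonneg_left h2 (CT_nonneg d))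

/-! ## §4. Joint holomorphy on the fat region, uniform in `n ≥ 1` -/

/-- the factor `p ↦ |v_λ|²`-continued, `uFactor n j (p λ)`, is holomorphic (jointly in `p`) at every point of the fat
region, for every residue `j`. [folklore] -/
theorem differentiableAt_uFactor_coord (n : ℕ) [NeZero n] (lam : Fin d) (j : Fin n) {r : ℝ} (hr : r ≤ 1 / 4)
    {q : Fin d → ℂ} (hq : q ∈ Fat d r) :
    DifferentiableAt ℂ (fun p : Fin d → ℂ => uFactor n (j : ℕ) (p lam)) q := by
  have hn : 1 ≤ n := Nat.one_le_iff_ne_zero.mpr (NeZero.ne n)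
  have hπ := Real.pi_gt_three
  have hF : DifferentiableAt ℂ (uFactor n (j : ℕ)) (q lam) := by
    by_cases hj : (j : ℕ) = 0
    · rw [hj]
      exact differentiableAt_uFactor_zero n hn (by linarith [(hq lam).1, hr])
    · exact differentiableAt_uFactor_ne n _ hj
        (Sxi_shift_ne_zero n _ (Nat.one_le_iff_ne_zero.mpr hj) j.isLt hr (hq lam).1)
  exact hF.comp q (differentiableAt_apply (𝕜 := ℂ) lam q)

/-- **the numerator is holomorphic (jointly) at every point of the fat region** (`r ≤ 1/4`, `d r² ≤ 1/16`),
every `n ≥ 1`. [folklore] -/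
theorem differentiableAt_numT (n : ℕ) [NeZero n] (lam : Fin d) {r : ℝ} (hr : r ≤ 1 / 4)
    (hdr : (d : ℝ) * r ^ 2 ≤ 1 / 16) {q : Fin d → ℂ} (hq : q ∈ Fat d r) :
    DifferentiableAt ℂ (numT n lam) q := by
  show DifferentiableAt ℂ (fun p => ∑ k ∈ Finset.univ.erase (fun _ => (0 : Fin n)),
    U n k p * uFactor n (k lam : ℕ) (p lam) * R n 0 k p) q
  apply DifferentiableAt.fun_sum
  intro k _
  exact ((differentiableAt_U n hr hq k).mul (differentiableAt_uFactor_coord n lam (k lam) hr hq)).mul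
    (differentiableAt_R n 0 le_rfl hr hdr hq k)

/-- **the denominator is holomorphic (jointly) at every point of the fat region** (`r ≤ 1/4`), every `n ≥ 1`. [folklore] -/
theorem differentiableAt_denT (n : ℕ) [NeZero n] (lam : Fin d) {r : ℝ} (hr : r ≤ 1 / 4)
    {q : Fin d → ℂ} (hq : q ∈ Fat d r) : DifferentiableAt ℂ (denT n lam) q := by
  show DifferentiableAt ℂ (fun p => U n (fun _ => (0 : Fin n)) p * uFactor n 0 (p lam)) q
  have h := differentiableAt_uFactor_coord n lam (0 : Fin n) hr hq
  simp only [Fin.val_zero] at h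
  exact (differentiableAt_U n hr hq _).mul h

/-- **`tSubOne n λ` is holomorphic (jointly in `p ∈ ℂ^d`) at every point of the fat region** (`r ≤ 1/4`,
`d r² ≤ 1/16`), for EVERY `n ≥ 1` and every `λ`. [folklore] -/
theorem differentiableAt_tSubOne (n : ℕ) [NeZero n] (lam : Fin d) {r : ℝ} (hr : r ≤ 1 / 4)
    (hdr : (d : ℝ) * r ^ 2 ≤ 1 / 16) {q : Fin d → ℂ} (hq : q ∈ Fat d r) :
    DifferentiableAt ℂ (tSubOne n lam) q := by
  show DifferentiableAt ℂ (fun p => numT n lam p / denT n lam p) q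
  exact dAt_div (differentiableAt_numT n lam hr hdr hq) (differentiableAt_denT n lam hr hq)
    (denT_ne_zero n lam hr hq)

/-- continuity on the fat region (pointwise from holomorphy). [folklore] -/
theorem continuousOn_tSubOne (n : ℕ) [NeZero n] (lam : Fin d) {r : ℝ} (hr : r ≤ 1 / 4)
    (hdr : (d : ℝ) * r ^ 2 ≤ 1 / 16) : ContinuousOn (tSubOne n lam) (Fat d r) :=
  fun _ hq => (differentiableAt_tSubOne n lam hr hdr hq).continuousAt.continuousWithinAt

/-! ## §5. The statement (S_t) -/

/-- **(S_t) ON THE FAT REGION `Fat d (rOf d)`**: for EVERY `n ≥ 1` and every `λ`, `tSubOne n λ` is holomorphic at every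
point `p` with `|Re p_ν| ≤ π + rOf d`, `|Im p_ν| ≤ 2 rOf d`, and `‖tSubOne n λ p‖ ≤ M_T(d)` there. [folklore] -/
theorem aliasRatio_fat (d : ℕ) (n : ℕ) [NeZero n] (lam : Fin d) (q : Fin d → ℂ) (hq : q ∈ Fat d (rOf d)) :
    DifferentiableAt ℂ (tSubOne n lam) q ∧ ‖tSubOne n lam q‖ ≤ MT d :=
  ⟨differentiableAt_tSubOne n lam (rOf_le d) (d_mul_rOf_sq_le d) hq,
    norm_tSubOne_le n lam (rOf_le d) (d_mul_rOf_sq_le d) hq⟩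

/-- **STATEMENT (S_t) OF BETA-SPEC 7.8 (ii) / 7.9 (AN1.md §14.6), KERNEL FORM.**  There are `δ = δ(d) > 0` and
`C = C(d) ≥ 0` (namely `δ = rOf d = 1/(4(d+1))`, `C = M_T(d)`) such that for EVERY `n = L^k ≥ 1` and every direction
`λ`: (i) `tSubOne n λ` is holomorphic, with `‖tSubOne n λ p‖ ≤ C`, at every complex momentum `p` with
`|Re p_ν| ≤ π + δ`, `|Im p_ν| ≤ δ` (a k-INDEPENDENT complex neighbourhood of the CLOSED Brillouin zone); (ii) on the
punctured real zone it IS the alias ratio minus one, `tSubOne n λ p′ = t_λ(p′) − 1 = a_λ(p′)/T₀,λ(p′) − 1`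
of (1.62). [folklore] -/
theorem statement_St (d : ℕ) : ∃ δ C : ℝ, 0 < δ ∧ 0 ≤ C ∧ ∀ (n : ℕ) [NeZero n] (lam : Fin d),
    (∀ q : Fin d → ℂ, (∀ ν, |(q ν).re| ≤ Real.pi + δ ∧ |(q ν).im| ≤ δ) →
      DifferentiableAt ℂ (tSubOne n lam) q ∧ ‖tSubOne n lam q‖ ≤ C) ∧
    (∀ s : Fin d → ℝ, (∀ ν, |s ν| ≤ Real.pi) → ∀ ν₀, s ν₀ ≠ 0 →
      tSubOne n lam (ofRealVec s) = ((tRatio n lam s - 1 : ℝ) : ℂ)) := by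
  refine ⟨rOf d, MT d, rOf_pos d, MT_nonneg d, ?_⟩
  intro n _ lam
  have hn : 1 ≤ n := Nat.one_le_iff_ne_zero.mpr (NeZero.ne n)
  refine ⟨fun q hq => ?_, fun s hs ν₀ hν₀ => tSubOne_ofRealVec n hn s hs ν₀ hν₀ lam⟩
  have hq' : q ∈ Fat d (rOf d) := fun ν => ⟨(hq ν).1, by linarith [(hq ν).2, rOf_pos d]⟩
  exact aliasRatio_fat d n lam q hq'

/-! ## §6. The first Cauchy consequences (tree engine `B4StripCauchy`), uniform in `n ≥ 1` -/

/-- the coordinate slices of `tSubOne` through the points of the fat region are holomorphic (the hypothesis shape of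
`B4StripCauchy.norm_deriv_slice_le`). [folklore] -/
theorem differentiableAt_tSubOne_slice (n : ℕ) [NeZero n] (lam : Fin d) {r : ℝ} (hr : r ≤ 1 / 4)
    (hdr : (d : ℝ) * r ^ 2 ≤ 1 / 16) {q : Fin d → ℂ} (hq : q ∈ Fat d r) (μ : Fin d) :
    DifferentiableAt ℂ (fun w => tSubOne n lam (Function.update q μ w)) (q μ) := by
  have hupd : DifferentiableAt ℂ (fun w : ℂ => Function.update q μ w) (q μ) :=
    differentiableAt_pi.mpr (fun ν => (differentiable_update_apply q μ ν) (q μ))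
  have hg : DifferentiableAt ℂ (tSubOne n lam) (Function.update q μ (q μ)) := by
    rw [Function.update_eq_self]
    exact differentiableAt_tSubOne n lam hr hdr hq
  exact hg.comp (q μ) hupd

/-- **CAUCHY'S ESTIMATE FOR `t_λ − 1`**: at every point `q` of every strip `Strip d κ` with `κ ≤ rOf d`, for EVERY
`n ≥ 1`, every `λ` and every coordinate `μ`: `‖∂_μ tSubOne n λ (q)‖ ≤ M_T(d)/rOf d = 4(d+1)·M_T(d)`. [folklore] -/
theorem norm_deriv_tSubOne_le (n : ℕ) [NeZero n] (lam : Fin d) {κ : ℝ} (hκ : κ ≤ rOf d) {q : Fin d → ℂ}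
    (hq : q ∈ Strip d κ) (μ : Fin d) :
    ‖deriv (fun w => tSubOne n lam (Function.update q μ w)) (q μ)‖ ≤ MT d / rOf d :=
  norm_deriv_slice_le (tSubOne n lam) (rOf_pos d) hκ
    (fun _ hp ν => differentiableAt_tSubOne_slice n lam (rOf_le d) (d_mul_rOf_sq_le d) hp ν)
    (fun _ hp => norm_tSubOne_le n lam (rOf_le d) (d_mul_rOf_sq_le d) hp) hq μ

/-- a real momentum of the closed zone is a point of the strip of half-width `0`. [folklore] -/
theorem ofRealVec_mem_Strip_zero {s : Fin d → ℝ} (hs : ∀ ν, |s ν| ≤ Real.pi) : ofRealVec s ∈ Strip d 0 := by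
  intro ν
  simp only [ofRealVec, Complex.ofReal_re, Complex.ofReal_im, abs_zero]
  exact ⟨hs ν, le_rfl⟩

/-- **the k-uniform first-derivative bound at real momenta**: for every `p′ ∈ [−π,π]^d`, `n ≥ 1`, `λ`, `μ`:
`‖(∂/∂p_μ)(t_λ − 1)‖ ≤ M_T(d)/rOf d` (complex derivative of the continuation `tSubOne` in the coordinate `μ`; on the
punctured zone `tSubOne = t_λ − 1`, `tSubOne_ofRealVec`). [folklore] -/
theorem norm_deriv_tSubOne_le_real (n : ℕ) [NeZero n] (lam μ : Fin d) {s : Fin d → ℝ}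
    (hs : ∀ ν, |s ν| ≤ Real.pi) :
    ‖deriv (fun w => tSubOne n lam (Function.update (ofRealVec s) μ w)) (s μ)‖ ≤ MT d / rOf d := by
  have h := norm_deriv_tSubOne_le n lam (rOf_pos d).le (ofRealVec_mem_Strip_zero hs) μ
  exact h

/-- **the imaginary-direction Lipschitz bound** (tree engine `B4StripCauchy.imLipschitz_of_fat`): on every strip
`Strip d κ`, `0 ≤ κ ≤ rOf d`, for every `n ≥ 1` and `λ`,
`‖tSubOne n λ p − tSubOne n λ (Re p)‖ ≤ (M_T(d)/rOf d) Σ_μ |Im p_μ|`. [folklore] -/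
theorem tSubOne_imLipschitz (n : ℕ) [NeZero n] (lam : Fin d) {κ : ℝ} (hκ0 : 0 ≤ κ) (hκ : κ ≤ rOf d) :
    ∀ p ∈ Strip d κ, ‖tSubOne n lam p - tSubOne n lam (ofRealVec (reVec p))‖ ≤ MT d / rOf d * ∑ μ, |(p μ).im| :=
  imLipschitz_of_fat (tSubOne n lam) (rOf_pos d) hκ0 hκ
    (fun _ hp ν => differentiableAt_tSubOne_slice n lam (rOf_le d) (d_mul_rOf_sq_le d) hp ν)
    (fun _ hp => norm_tSubOne_le n lam (rOf_le d) (d_mul_rOf_sq_le d) hp)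

/-! ## §7. The `l ≠ 0` tail is quadratically small: complex QUARTIC smallness of `tSubOne` (v1.1) -/

/-- `∑_{j<n} 1/(j+1)² ≤ π²/6 ≤ 2` (Mathlib `hasSum_zeta_two`). [folklore] -/
theorem sum_inv_succ_sq_le_two (n : ℕ) : ∑ j : Fin n, 1 / (((j : ℕ) : ℝ) + 1) ^ 2 ≤ 2 := by
  rw [Fin.sum_univ_eq_sum_range (fun i => 1 / ((i : ℝ) + 1) ^ 2) n]
  have h1 : ∑ i ∈ Finset.range n, 1 / ((i : ℝ) + 1) ^ 2 =
      ∑ i ∈ Finset.range (n + 1), 1 / (i : ℝ) ^ 2 := by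
    rw [Finset.sum_range_succ']; simp
  rw [h1]
  have h2 := sum_le_hasSum (Finset.range (n + 1)) (fun i _ => by positivity) hasSum_zeta_two
  have hπ := Real.pi_lt_d2
  have : Real.pi ^ 2 / 6 ≤ 2 := by nlinarith [Real.pi_pos]
  linarith

/-- `‖S1 z‖ ≤ (25/16)‖z‖²` for `|Im z| ≤ 1` (`S1 = Sxi 1`, `B4StripCauchy.norm_Sxi_le`). [folklore] -/
theorem norm_S1_le_sq (z : ℂ) (hy : |z.im| ≤ 1) : ‖S1 z‖ ≤ 25 / 16 * ‖z‖ ^ 2 := by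
  rw [S1_eq_Sxi_one]
  refine (norm_Sxi_le 1 le_rfl z hy).trans ?_
  rw [Complex.sq_norm, Complex.normSq_apply]
  nlinarith [sq_nonneg z.re, sq_nonneg z.im]

/-- a shifted (`j ≠ 0`) alias weight keeps the factor `S1 z = 4 sin²(z/2)`:
`‖u_n(j; z)‖ ≤ ‖S1 z‖ · (2/(j+1)² + 2/(n−j)²)` on `|Re z| ≤ π + r`, `r ≤ 1/4` (`B4StripCauchy.inv_norm_Sxi_shift_le`).
[folklore] -/
theorem norm_uFactor_ne_le_S1 (n j : ℕ) (hj : 1 ≤ j) (hjn : j + 1 ≤ n) {z : ℂ} {r : ℝ}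
    (hr : r ≤ 1 / 4) (hx : |z.re| ≤ Real.pi + r) :
    ‖uFactor n j z‖ ≤ ‖S1 z‖ * (2 / ((j : ℝ) + 1) ^ 2 + 2 / ((n : ℝ) - j) ^ 2) := by
  rw [uFactor_ne_eq n j (by omega), norm_div]
  have h2 := inv_norm_Sxi_shift_le n j hj hjn hr hx (z := z)
  calc ‖S1 z‖ / ‖Sxi n (z + 2 * Real.pi * (j : ℂ))‖
        = ‖S1 z‖ * (1 / ‖Sxi n (z + 2 * Real.pi * (j : ℂ))‖) := by ring
    _ ≤ ‖S1 z‖ * (2 / ((j : ℝ) + 1) ^ 2 + 2 / ((n : ℝ) - j) ^ 2) :=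
        mul_le_mul_of_nonneg_left h2 (norm_nonneg _)

/-- **the one-variable `l ≠ 0` tail: `∑_{j ≠ 0} ‖u_n(j; z)‖ ≤ 8 ‖S1 z‖`** on `|Re z| ≤ π + r` (`r ≤ 1/4`), uniformly in `n`.
[folklore] -/
theorem sum_norm_uFactor_ne_le (n : ℕ) [NeZero n] {z : ℂ} {r : ℝ} (hr : r ≤ 1 / 4)
    (hx : |z.re| ≤ Real.pi + r) :
    ∑ j ∈ Finset.univ.erase (0 : Fin n), ‖uFactor n (j : ℕ) z‖ ≤ 8 * ‖S1 z‖ := by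
  have hterm : ∀ j ∈ Finset.univ.erase (0 : Fin n), ‖uFactor n (j : ℕ) z‖ ≤
      ‖S1 z‖ * (2 / (((j : ℕ) : ℝ) + 1) ^ 2 + 2 / ((n : ℝ) - (j : ℕ)) ^ 2) := by
    intro j hj
    have hj0 : j ≠ 0 := Finset.ne_of_mem_erase hj
    have hj1 : 1 ≤ (j : ℕ) := Nat.one_le_iff_ne_zero.mpr (fun h => hj0 (Fin.ext h))
    exact norm_uFactor_ne_le_S1 n j hj1 j.isLt hr hx
  have hnn : ∀ j ∈ (Finset.univ : Finset (Fin n)),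
      0 ≤ ‖S1 z‖ * (2 / (((j : ℕ) : ℝ) + 1) ^ 2 + 2 / ((n : ℝ) - (j : ℕ)) ^ 2) := by
    intro j _
    have : ((j : ℕ) : ℝ) + 1 ≤ n := by exact_mod_cast j.isLt
    have : 0 < (n : ℝ) - (j : ℕ) := by linarith
    positivity
  calc ∑ j ∈ Finset.univ.erase (0 : Fin n), ‖uFactor n (j : ℕ) z‖
      ≤ ∑ j ∈ Finset.univ.erase (0 : Fin n),
          ‖S1 z‖ * (2 / (((j : ℕ) : ℝ) + 1) ^ 2 + 2 / ((n : ℝ) - (j : ℕ)) ^ 2) := Finset.sum_le_sum hterm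
    _ ≤ ∑ j : Fin n, ‖S1 z‖ * (2 / (((j : ℕ) : ℝ) + 1) ^ 2 + 2 / ((n : ℝ) - (j : ℕ)) ^ 2) :=
        Finset.sum_le_sum_of_subset_of_nonneg (Finset.erase_subset _ _) (fun j hj _ => hnn j hj)
    _ = ‖S1 z‖ * (2 * ∑ j : Fin n, 1 / (((j : ℕ) : ℝ) + 1) ^ 2 + 2 * ∑ j : Fin n, 1 / ((n : ℝ) - (j : ℕ)) ^ 2) := by
        rw [← Finset.mul_sum, Finset.sum_add_distrib, Finset.mul_sum, Finset.mul_sum]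
        congr 1
        refine congrArg₂ (· + ·) (Finset.sum_congr rfl fun j _ => ?_) (Finset.sum_congr rfl fun j _ => ?_) <;> ring
    _ = ‖S1 z‖ * (4 * ∑ j : Fin n, 1 / (((j : ℕ) : ℝ) + 1) ^ 2) := by rw [sum_reflect_inv_sq]; ring
    _ ≤ ‖S1 z‖ * (4 * 2) := by gcongr; exact sum_inv_succ_sq_le_two n
    _ = 8 * ‖S1 z‖ := by ring

/-- union bound: a nonnegative sum over `k ≠ 0` is at most the sum over `μ₀` of the sums over `{k : k_{μ₀} ≠ 0}`
(every `k ≠ 0` has a nonzero coordinate). [folklore] -/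
theorem sum_erase_zero_le_sum_coord (n : ℕ) [NeZero n] (g : (Fin d → Fin n) → ℝ) (hg : ∀ k, 0 ≤ g k) :
    ∑ k ∈ Finset.univ.erase (fun _ => (0 : Fin n)), g k ≤
      ∑ μ₀ : Fin d, ∑ k ∈ Finset.univ.filter (fun k : Fin d → Fin n => k μ₀ ≠ 0), g k := by
  classical
  have hcover : ∀ k ∈ Finset.univ.erase (fun _ => (0 : Fin n)),
      g k ≤ ∑ μ₀ : Fin d, if k μ₀ ≠ 0 then g k else 0 := by
    intro k hk
    have hk0 : k ≠ fun _ => 0 := Finset.ne_of_mem_erase hk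
    obtain ⟨μ₀, hμ₀⟩ : ∃ μ₀, k μ₀ ≠ 0 := by
      by_contra h
      push Not at h
      exact hk0 (funext h)
    calc g k = if k μ₀ ≠ 0 then g k else 0 := by rw [if_pos hμ₀]
      _ ≤ ∑ μ : Fin d, if k μ ≠ 0 then g k else 0 :=
          Finset.single_le_sum (f := fun μ => if k μ ≠ 0 then g k else 0)
            (fun μ _ => by split_ifs <;> simp [hg k]) (Finset.mem_univ μ₀)
  calc ∑ k ∈ Finset.univ.erase (fun _ => (0 : Fin n)), g k
      ≤ ∑ k ∈ Finset.univ.erase (fun _ => (0 : Fin n)), ∑ μ₀ : Fin d, (if k μ₀ ≠ 0 then g k else 0) :=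
        Finset.sum_le_sum hcover
    _ ≤ ∑ k : Fin d → Fin n, ∑ μ₀ : Fin d, (if k μ₀ ≠ 0 then g k else 0) :=
        Finset.sum_le_sum_of_subset_of_nonneg (Finset.erase_subset _ _)
          (fun k _ _ => Finset.sum_nonneg fun μ _ => by split_ifs <;> simp [hg k])
    _ = ∑ μ₀ : Fin d, ∑ k : Fin d → Fin n, (if k μ₀ ≠ 0 then g k else 0) := Finset.sum_comm
    _ = ∑ μ₀ : Fin d, ∑ k ∈ Finset.univ.filter (fun k : Fin d → Fin n => k μ₀ ≠ 0), g k := by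
        refine Finset.sum_congr rfl fun μ₀ _ => ?_
        rw [Finset.sum_filter]

/-- the coordinate sections `{k : k_{μ₀} ≠ 0}` are boxes: `Σ_{k : k_{μ₀} ≠ 0} Π_μ f_μ(k_μ) = (Σ_{j≠0} f_{μ₀}(j)) ·
Π_{μ ≠ μ₀} Σ_j f_μ(j)` (`Finset.prod_univ_sum`). [folklore] -/
theorem sum_filter_coord_ne_prod (n : ℕ) [NeZero n] (μ₀ : Fin d) (f : Fin d → Fin n → ℝ) :
    ∑ k ∈ Finset.univ.filter (fun k : Fin d → Fin n => k μ₀ ≠ 0), ∏ μ, f μ (k μ) =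
      (∑ j ∈ Finset.univ.erase (0 : Fin n), f μ₀ j) * ∏ μ ∈ Finset.univ.erase μ₀, ∑ j : Fin n, f μ j := by
  classical
  set t : Fin d → Finset (Fin n) :=
    Function.update (fun _ : Fin d => (Finset.univ : Finset (Fin n))) μ₀ (Finset.univ.erase 0) with ht
  have hset : Finset.univ.filter (fun k : Fin d → Fin n => k μ₀ ≠ 0) = Fintype.piFinset t := by
    ext k
    simp only [Finset.mem_filter, Finset.mem_univ, true_and, Fintype.mem_piFinset, ht]
    constructor
    · intro hk μ
      by_cases hμ : μ = μ₀
      · subst hμ; rw [Function.update_self]; exact Finset.mem_erase.mpr ⟨hk, Finset.mem_univ _⟩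
      · rw [Function.update_of_ne hμ]; exact Finset.mem_univ _
    · intro hk
      have := hk μ₀
      rw [Function.update_self, Finset.mem_erase] at this
      exact this.1
  rw [hset, ← Finset.prod_univ_sum t f, ← Finset.mul_prod_erase Finset.univ _ (Finset.mem_univ μ₀)]
  congr 1
  · rw [ht, Function.update_self]
  · refine Finset.prod_congr rfl fun μ hμ => ?_
    rw [ht, Function.update_of_ne (Finset.ne_of_mem_erase hμ)]

/-- **THE `l ≠ 0` TAIL IS QUADRATICALLY SMALL: `Σ_{k ≠ 0} ‖U n k p‖ ≤ 8 · 132^d · Σ_μ ‖S1 (p_μ)‖`** on the fat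
region `F_r` (`r ≤ 1/4`), uniformly in `n ≥ 1` (`S1(p_μ) = 4 sin²(p_μ/2)` vanishes to second order at `p_μ = 0`;
one-variable tail `≤ 8‖S1‖`, the other coordinates by `B4StripCauchy.sum_norm_uFactor_le ≤ 132`). [folklore] -/
theorem sum_norm_U_ne_le (n : ℕ) [NeZero n] {r : ℝ} (hr : r ≤ 1 / 4) {q : Fin d → ℂ} (hq : q ∈ Fat d r) :
    ∑ k ∈ Finset.univ.erase (fun _ => (0 : Fin n)), ‖U n k q‖ ≤ 8 * 132 ^ d * ∑ μ, ‖S1 (q μ)‖ := by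
  classical
  have h1 := sum_erase_zero_le_sum_coord n (fun k => ‖U n k q‖) (fun k => norm_nonneg _)
  refine h1.trans ?_
  rw [Finset.mul_sum]
  refine Finset.sum_le_sum fun μ₀ _ => ?_
  simp_rw [norm_U_eq]
  rw [sum_filter_coord_ne_prod n μ₀ (fun μ j => ‖uFactor n (j : ℕ) (q μ)‖)]
  have hA := sum_norm_uFactor_ne_le n hr (hq μ₀).1 (z := q μ₀)
  have hB : ∏ μ ∈ Finset.univ.erase μ₀, ∑ j : Fin n, ‖uFactor n (j : ℕ) (q μ)‖ ≤ 132 ^ d := by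
    calc ∏ μ ∈ Finset.univ.erase μ₀, ∑ j : Fin n, ‖uFactor n (j : ℕ) (q μ)‖
        ≤ ∏ _μ ∈ Finset.univ.erase μ₀, (132 : ℝ) :=
          Finset.prod_le_prod (fun _ _ => Finset.sum_nonneg (fun _ _ => norm_nonneg _))
            (fun μ _ => sum_norm_uFactor_le n hr (hq μ).1 (hq μ).2)
      _ = 132 ^ (Finset.univ.erase μ₀).card := Finset.prod_const _
      _ ≤ 132 ^ d := by
          refine pow_le_pow_right₀ (by norm_num) ?_
          exact (Finset.card_le_univ _).trans (by simp)
  have hA0 : 0 ≤ ∑ j ∈ Finset.univ.erase (0 : Fin n), ‖uFactor n (j : ℕ) (q μ₀)‖ :=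
    Finset.sum_nonneg fun _ _ => norm_nonneg _
  calc (∑ j ∈ Finset.univ.erase (0 : Fin n), ‖uFactor n (j : ℕ) (q μ₀)‖) *
        ∏ μ ∈ Finset.univ.erase μ₀, ∑ j : Fin n, ‖uFactor n (j : ℕ) (q μ)‖
      ≤ (8 * ‖S1 (q μ₀)‖) * 132 ^ d := mul_le_mul hA hB (Finset.prod_nonneg fun _ _ =>
          Finset.sum_nonneg fun _ _ => norm_nonneg _) (by positivity)
    _ = 8 * 132 ^ d * ‖S1 (q μ₀)‖ := by ring

/-- the tail in terms of `‖p‖`: `Σ_{k ≠ 0} ‖U n k p‖ ≤ (25/2) · 132^d · Σ_μ ‖p_μ‖²` on `F_r` (`r ≤ 1/4`). [folklore] -/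
theorem sum_norm_U_ne_le_norm_sq (n : ℕ) [NeZero n] {r : ℝ} (hr : r ≤ 1 / 4) {q : Fin d → ℂ}
    (hq : q ∈ Fat d r) :
    ∑ k ∈ Finset.univ.erase (fun _ => (0 : Fin n)), ‖U n k q‖ ≤ 25 / 2 * 132 ^ d * ∑ μ, ‖q μ‖ ^ 2 := by
  refine (sum_norm_U_ne_le n hr hq).trans ?_
  have hq1 : ∀ μ, |(q μ).im| ≤ 1 := fun μ => by linarith [(hq μ).2]
  have h : ∑ μ, ‖S1 (q μ)‖ ≤ 25 / 16 * ∑ μ, ‖q μ‖ ^ 2 := by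
    rw [Finset.mul_sum]
    exact Finset.sum_le_sum fun μ _ => norm_S1_le_sq (q μ) (hq1 μ)
  calc 8 * 132 ^ d * ∑ μ, ‖S1 (q μ)‖ ≤ 8 * 132 ^ d * (25 / 16 * ∑ μ, ‖q μ‖ ^ 2) :=
        mul_le_mul_of_nonneg_left h (by positivity)
    _ = 25 / 2 * 132 ^ d * ∑ μ, ‖q μ‖ ^ 2 := by ring

/-- **`‖numT n λ p‖ ≤ 8 · 132^d · 64 · (64/7) · ‖Δ^η(p)‖ · Σ_μ ‖S1(p_μ)‖`** on the fat region (`r ≤ 1/4`,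
`d r² ≤ 1/16`), every `n ≥ 1`: the numerator vanishes to FOURTH order at `p = 0` (`‖Δ^η(p)‖ = O(‖p‖²)` times the
quadratically small `l ≠ 0` tail). [folklore] -/
theorem norm_numT_le_tail (n : ℕ) [NeZero n] (lam : Fin d) {r : ℝ} (hr : r ≤ 1 / 4)
    (hdr : (d : ℝ) * r ^ 2 ≤ 1 / 16) {q : Fin d → ℂ} (hq : q ∈ Fat d r) :
    ‖numT n lam q‖ ≤ 8 * 132 ^ d * 64 * (64 / 7) * ‖DeltaXi n 0 q‖ * ∑ μ, ‖S1 (q μ)‖ := by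
  unfold numT
  set B : ℝ := 64 * (64 / 7 * ‖DeltaXi n 0 q‖) with hB
  have hB0 : 0 ≤ B := by rw [hB]; positivity
  have hterm : ∀ k ∈ Finset.univ.erase (fun _ => (0 : Fin n)),
      ‖U n k q * uFactor n (k lam : ℕ) (q lam) * R n 0 k q‖ ≤ ‖U n k q‖ * B := by
    intro k hk
    have hk0 : k ≠ fun _ => 0 := Finset.ne_of_mem_erase hk
    rw [norm_mul, norm_mul, mul_assoc]
    refine mul_le_mul_of_nonneg_left ?_ (norm_nonneg _)
    exact mul_le_mul (norm_uFactor_le_64 n (k lam) hr (hq lam).1 (hq lam).2)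
      (norm_R_zero_le n hr hdr hq k hk0) (norm_nonneg _) (by norm_num)
  calc ‖∑ k ∈ Finset.univ.erase (fun _ => (0 : Fin n)), U n k q * uFactor n (k lam : ℕ) (q lam) * R n 0 k q‖
      ≤ ∑ k ∈ Finset.univ.erase (fun _ => (0 : Fin n)), ‖U n k q * uFactor n (k lam : ℕ) (q lam) * R n 0 k q‖ :=
        norm_sum_le _ _
    _ ≤ ∑ k ∈ Finset.univ.erase (fun _ => (0 : Fin n)), ‖U n k q‖ * B := Finset.sum_le_sum hterm
    _ = (∑ k ∈ Finset.univ.erase (fun _ => (0 : Fin n)), ‖U n k q‖) * B := by rw [Finset.sum_mul]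
    _ ≤ (8 * 132 ^ d * ∑ μ, ‖S1 (q μ)‖) * B := mul_le_mul_of_nonneg_right (sum_norm_U_ne_le n hr hq) hB0
    _ = 8 * 132 ^ d * 64 * (64 / 7) * ‖DeltaXi n 0 q‖ * ∑ μ, ‖S1 (q μ)‖ := by rw [hB]; ring

/-- **`‖tSubOne n λ p‖ ≤ 8 · C_T(d) · ‖Δ^η(p)‖ · Σ_μ ‖S1(p_μ)‖`** on the fat region (`r ≤ 1/4`, `d r² ≤ 1/16`), every
`n ≥ 1`. [folklore] -/
theorem norm_tSubOne_le_tail (n : ℕ) [NeZero n] (lam : Fin d) {r : ℝ} (hr : r ≤ 1 / 4)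
    (hdr : (d : ℝ) * r ^ 2 ≤ 1 / 16) {q : Fin d → ℂ} (hq : q ∈ Fat d r) :
    ‖tSubOne n lam q‖ ≤ 8 * CT d * ‖DeltaXi n 0 q‖ * ∑ μ, ‖S1 (q μ)‖ := by
  unfold tSubOne CT
  rw [norm_div]
  have hden := norm_denT_ge n lam hr hq
  have hnum := norm_numT_le_tail n lam hr hdr hq
  have hc : (0 : ℝ) < (3 / 16 : ℝ) ^ (d + 1) := by positivity
  have hpos : 0 < ‖denT n lam q‖ := lt_of_lt_of_le hc hden
  rw [div_le_iff₀ hpos]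
  have hS0 : 0 ≤ ∑ μ, ‖S1 (q μ)‖ := Finset.sum_nonneg fun _ _ => norm_nonneg _
  calc ‖numT n lam q‖ ≤ 8 * 132 ^ d * 64 * (64 / 7) * ‖DeltaXi n 0 q‖ * ∑ μ, ‖S1 (q μ)‖ := hnum
    _ = 8 * (132 ^ d * 64 * (64 / 7) / (3 / 16 : ℝ) ^ (d + 1)) * ‖DeltaXi n 0 q‖ * (∑ μ, ‖S1 (q μ)‖) *
          (3 / 16 : ℝ) ^ (d + 1) := by
        field_simp
    _ ≤ 8 * (132 ^ d * 64 * (64 / 7) / (3 / 16 : ℝ) ^ (d + 1)) * ‖DeltaXi n 0 q‖ * (∑ μ, ‖S1 (q μ)‖) *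
          ‖denT n lam q‖ :=
        mul_le_mul_of_nonneg_left hden (by positivity)

/-- the constant of the quartic bound: `C_T⁽⁴⁾(d) = 8 · (25/16)² · C_T(d)`. [folklore] -/
def CT4 (d : ℕ) : ℝ := 8 * (25 / 16) ^ 2 * CT d

/-- `C_T⁽⁴⁾(d) ≥ 0`. [folklore] -/
theorem CT4_nonneg (d : ℕ) : 0 ≤ CT4 d := by unfold CT4; have := CT_nonneg d; positivity

/-- **COMPLEX QUARTIC SMALLNESS `‖tSubOne n λ p‖ ≤ C_T⁽⁴⁾(d) · (Σ_ν ‖p_ν‖²)²`** on the WHOLE fat region `F_r`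
(`r ≤ 1/4`, `d r² ≤ 1/16`), for EVERY `n ≥ 1` and every direction `λ`: the complex, `n`-uniform form of the
fourth-order vanishing of `t_λ − 1` at `p′ = 0` (the real statement is `Beta.SymbolExpansion.tRatio_sub_one_le'`;
here `‖Δ^η(p)‖ ≤ (25/16)Σ‖p_ν‖²` and `Σ_μ‖S1(p_μ)‖ ≤ (25/16)Σ‖p_μ‖²`). [folklore] -/
theorem norm_tSubOne_le_pow_four (n : ℕ) [NeZero n] (lam : Fin d) {r : ℝ} (hr : r ≤ 1 / 4)
    (hdr : (d : ℝ) * r ^ 2 ≤ 1 / 16) {q : Fin d → ℂ} (hq : q ∈ Fat d r) :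
    ‖tSubOne n lam q‖ ≤ CT4 d * (∑ ν, ‖q ν‖ ^ 2) ^ 2 := by
  have hn : 1 ≤ n := Nat.one_le_iff_ne_zero.mpr (NeZero.ne n)
  have h1 := norm_tSubOne_le_tail n lam hr hdr hq
  have hq1 : ∀ ν, |(q ν).im| ≤ 1 := fun ν => by linarith [(hq ν).2]
  have h2 := norm_DeltaXi_zero_le_norm_sq n hn hq1
  have h3 : ∑ μ, ‖S1 (q μ)‖ ≤ 25 / 16 * ∑ μ, ‖q μ‖ ^ 2 := by
    rw [Finset.mul_sum]
    exact Finset.sum_le_sum fun μ _ => norm_S1_le_sq (q μ) (hq1 μ)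
  have hS0 : 0 ≤ ∑ μ, ‖S1 (q μ)‖ := Finset.sum_nonneg fun _ _ => norm_nonneg _
  have hC := CT_nonneg d
  calc ‖tSubOne n lam q‖ ≤ 8 * CT d * ‖DeltaXi n 0 q‖ * ∑ μ, ‖S1 (q μ)‖ := h1
    _ ≤ 8 * CT d * (25 / 16 * ∑ ν, ‖q ν‖ ^ 2) * (25 / 16 * ∑ μ, ‖q μ‖ ^ 2) := by
        apply mul_le_mul _ h3 hS0 (by positivity)
        exact mul_le_mul_of_nonneg_left h2 (by positivity)
    _ = CT4 d * (∑ ν, ‖q ν‖ ^ 2) ^ 2 := by unfold CT4; ring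

/-- **(S_t), quartic form**, on the standard fat region `Fat d (rOf d)`: for every `n ≥ 1`, `λ` and `p ∈ F_{r(d)}`,
`‖tSubOne n λ p‖ ≤ min (M_T(d)) (C_T⁽⁴⁾(d)·(Σ‖p_ν‖²)²)`. [folklore] -/
theorem aliasRatio_fat_quartic (d : ℕ) (n : ℕ) [NeZero n] (lam : Fin d) (q : Fin d → ℂ)
    (hq : q ∈ Fat d (rOf d)) :
    ‖tSubOne n lam q‖ ≤ min (MT d) (CT4 d * (∑ ν, ‖q ν‖ ^ 2) ^ 2) :=
  le_min (norm_tSubOne_le n lam (rOf_le d) (d_mul_rOf_sq_le d) hq)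
    (norm_tSubOne_le_pow_four n lam (rOf_le d) (d_mul_rOf_sq_le d) hq)

end

end Literature.MathematicalPhysics.QuantumFieldTheory.Balaban1983to89.Beta.AliasRatioStrip
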